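import Mathlib
import HarnessLib
import Summits.CriticalPhenomena.CardyFormulaZ2.Theses.CardyIKTransport
import Literature.Probability.LatticeModels.CornerFugacityMeasure
import Literature.Probability.LatticeModels.CellGridSaddlePercolation

/-!
# Sketch — crux-ideate stmt-CriticalPhenomena-10964 (CardyIKTransport.CornerLineDescent), ideator 2, round 1

First lemmas of the two idea cards, typed over existing declarations (nothing proved here).
-/

noncomputable section

namespace Summit.CriticalPhenomena.CardyFormulaZ2.Cruxes.CornerLineDescent.Ideas

open MeasureTheory ProbabilityTheory
open Literature.Probability.LatticeModels Literature.Probability.RandomPlanarGeometry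

/-! ## Card `saddle-graph-fibrewise-fkg` -/

/-- (a) Fibrewise monotonicity: for a FIXED colouring `σ`, black connectivity is increasing in the
"black-bond" bits `σ w == κ w` read at the checkerboard faces of `σ`, and does not depend on the
coins at non-checkerboard faces. -/
def FibrewiseMonotone : Prop :=
  ∀ (σ κ κ' : Site 2 → Bool),
    (∀ w, IsCheckerboard σ w → (σ w == κ w) = true → (σ w == κ' w) = true) →
    ∀ x y : Site 2, (blackGraph (σ, κ)).Reachable x y → (blackGraph (σ, κ')).Reachable x y

/-- (b) Fibrewise planar duality: white connectivity is decreasing in the same bits. -/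
def FibrewiseDual : Prop :=
  ∀ (σ κ κ' : Site 2 → Bool),
    (∀ w, IsCheckerboard σ w → (σ w == κ w) = true → (σ w == κ' w) = true) →
    ∀ x y : Site 2, (whiteGraph (σ, κ')).Reachable x y → (whiteGraph (σ, κ)).Reachable x y

/-- (c) The black-bond field of a fair coin field is again a fair coin field (XOR with the fixed
pattern `σ` preserves `coinMeasure ½`), so every colour fibre carries an i.i.d. Bernoulli(½) BOND
percolation on the saddle graph of `σ`, coupled to its planar dual. -/
def BlackBondFair : Prop :=
  ∀ σ : Site 2 → Bool,
    (coinMeasure Literature.Probability.Percolation.half).map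
        (fun κ : Site 2 → Bool => fun w => (σ w == κ w)) =
      coinMeasure Literature.Probability.Percolation.half

/-! ## Card `sharp-seam-chimera` -/

/-- Column differences are i.i.d. fair under the FREE corner-fugacity measure on a box, for EVERY
corner fugacity `t` (including the frozen point `t = 0`): the law of
`(σ(x,j) ⊕ σ(x,j+1))_{j<n}` is uniform on `Fin n → Bool`.  (Characters: a product of cells has
non-zero mean only if it meets every row and every column evenly.)  Consequence used by the card:
the IK seam column hands the corner-free side EXACTLY the renewal (geometric, mean 2) row law of
`M(0,½)`. -/
def ColumnDifferencesUniform : Prop :=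
  ∀ (t : NNReal) (m n : ℕ) (x : ℤ), 0 ≤ x → x < m →
    (freeCornerFugacityMeasure t Literature.Probability.Percolation.half
          (((Finset.Ico (0:ℤ) m) ×ˢ (Finset.Icc (0:ℤ) n)).image fun p : ℤ × ℤ => ![p.1, p.2])).map
        (fun ω : CellConfig => fun j : Fin n => xor (ω.1 ![x, (j : ℤ)]) (ω.1 ![x, (j : ℤ) + 1])) =
      ((2 : ENNReal)⁻¹ ^ n) • (Measure.count : Measure (Fin n → Bool))

/-- The sharp-seam chimera: corner fugacity `t` on the faces `w` with `w 0 < S`, fugacity `0`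
(no odd face allowed) on the faces with `S ≤ w 0`, free boundary, fair coins; its crude crossing
probability of the conformal rectangle `R` at mesh `δ` (G02 cell event, as `cornerCrossingProb`). -/
def seamCrossingProb (t : NNReal) (S : ℤ) (R : ConformalRectangle) (δ : ℝ) : ℝ :=
  let Λ := cellBox R.carrier δ
  let V := (innerVertices Λ).filter fun w => w 0 < S
  let E : Set (Site 2 → Bool) := {σ | ∀ w ∈ innerVertices Λ, S ≤ w 0 → ¬ IsOddFace σ w}
  ((ProbabilityTheory.cond (cornerGibbsMeasure t V Λ fun _ => false) E).prod
      (coinMeasure Literature.Probability.Percolation.half)).real (cellDomainCrossing R δ)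

/-- SEAM INVISIBILITY (the one new statement of the card): moving the IK | bond seam by a
macroscopic amount does not change crossing limits. -/
def SeamInvisibility : Prop :=
  ∀ (R : ConformalRectangle) (s s' : ℝ),
    Filter.Tendsto
      (fun δ : ℝ => seamCrossingProb (ikCornerFugacity (Real.pi / 2)) ⌊s / δ⌋ R δ -
        seamCrossingProb (ikCornerFugacity (Real.pi / 2)) ⌊s' / δ⌋ R δ)
      (nhdsWithin 0 (Set.Ioi 0)) (nhds 0)

/-- Far-left quads see the pure IK model (hot-side forgetting, Dobrushin at J = -½ log(√3/2)):
with the seam far to the right of `R`, the chimera has the IK crossing limits. -/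
def HotSideForgetting : Prop :=
  ∀ (R : ConformalRectangle) (L : ℝ),
    (∀ z ∈ R.carrier, z.re < 0) →
    Filter.Tendsto
      (fun δ : ℝ => seamCrossingProb (ikCornerFugacity (Real.pi / 2)) ⌊1 / δ⌋ R δ -
        ikCrossingProb (Real.pi / 2) R δ)
      (nhdsWithin 0 (Set.Ioi 0)) (nhds 0)

end Summit.CriticalPhenomena.CardyFormulaZ2.Cruxes.CornerLineDescent.Ideas
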